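import Summits.Ventures.Crystal3D.Kissing125.GSearchDefs2
import HarnessLib

/-!
# Structures, codes and semantics of the growth search, κ-generic — part 3/3

HONEST FRAMING (cell pub-crystal3d, K-path at `h = 5/4`, V4 = κ as an explicit parameter): this is NOT a result printed
by Hales; it is his METHOD (arXiv:1209.6043, Theorem 3 + Lemmas 7–10, in the tree's form of a verified interval-arithmetic
growth search, `Literature/…/KissingSearch*.lean`) with the largest long-side cosine `κ` made an EXPLICIT PARAMETER
(`κ : Kappa`, carrying the two numeric facts the soundness proof uses: `-1/2 ≤ κ`, `κ < 1/4`).  Only the declarations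
whose statement depends on `κ` are declared here (namespace `…Kissing125.GSearch`, the tree's short names, no renames);
every κ-free helper is the landed K25 copy (`…Kissing125.KissingSearch.*`) and every κ-free lemma is cited from the tree
(PRIVATE per-file citation aliases; `GSearchTransport.lean` holds `toT : St → tree St` and the transport equalities).  The K25
instance is `κ25 = ⟨7/32, …⟩`; `GSearchBridge.lean` identifies the generic checker at
`κ25` with the landed `Kissing125.KissingSearch.checkPart`, so the landed run files are consumed unchanged.  Generated by
`HOME/lean/kissing125/v4-prep/gen/mkgen.py`; nothing here is asserted about GAP(1.26) or any census.

THIS FILE: the κ-tainted declarations of `Literature/Geometry/DiscreteGeometry/KissingSearchDefs.lean` (part 3 of 3), with `κ : Kappa` threaded; κ-free declarations of that file are NOT re-declared publicly (the κ-free helpers are the landed K25 copies; the κ-free tree lemmas used by the proofs are cited through PRIVATE aliases at the top of the file).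

## References
* T. C. Hales, *A proof of Fejes Tóth's conjecture on sphere packings with kissing number twelve*,
  arXiv:1209.6043 (2012): Definition 1, Theorem 2, Theorem 3, Lemmas 7–10. [`Hales2012`]
* R. E. Moore, *Interval Analysis* (1966), Theorem 3.1, §4.4. [`Moore1966`]
-/

namespace Summit.Ventures.Crystal3D.Kissing125

open Literature.Geometry.DiscreteGeometry
open Summit.Ventures.Crystal3D.Kissing125.KissingSearch

namespace GSearch

open Real Literature.Analysis.ValidatedNumerics KissingLP NonemptyInterval Finset

variable {κ : Kappa}


section Relabel
variable (M : KConf κ) (σ : Equiv.Perm ℕ) (hσ : ∀ a, σ a < 12 ↔ a < 12)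
/-- **The conclusion is invariant under relabelling.** [folklore] -/
theorem KConf.concl_of_relabel (M : KConf κ) (σ : Equiv.Perm ℕ) (hσ : ∀ a, σ a < 12 ↔ a < 12) (h : (M.relabel σ hσ).Concl) : M.Concl := by
  obtain ⟨i, hi, e, he⟩ := h
  -- σ restricted to `Fin 12`
  let τ : Fin 12 → Fin 12 := fun a => ⟨σ a, (hσ a).2 a.2⟩
  have hτ : Function.Injective τ := fun a b h => by
    have : σ a = σ b := by simpa [τ] using congrArg Fin.val h
    exact Fin.ext (σ.injective this)
  have hτb : Function.Bijective τ := (Finite.injective_iff_bijective).1 hτ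
  let τe : Fin 12 ≃ Fin 12 := Equiv.ofBijective τ hτb
  refine ⟨i, hi, τe.trans e, fun a b => ?_⟩
  have h := he (τe a) (τe b)
  simp only [Equiv.trans_apply]
  rw [← h]
  have hg : (M.relabel σ hσ).g (τe a) (τe b) = M.g a b := by
    show M.g (σ.symm (σ a)) (σ.symm (σ b)) = M.g a b; simp
  have hne : ((τe a : Fin 12) : ℕ) ≠ (τe b : ℕ) ↔ (a : ℕ) ≠ b := by
    show σ a ≠ σ b ↔ (a : ℕ) ≠ b; exact σ.injective.ne_iff
  rw [hg, hne]

end Relabel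


end GSearch

end Summit.Ventures.Crystal3D.Kissing125
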